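import Mathlib.RingTheory.MvPolynomial.Symmetric.Defs
import Mathlib.Tactic
import Literature.Geometry.Riemannian.TwoConvexSchoenfliesProofs
import HarnessLib

/-!
# Conditional-Poisson monotonicity (Lemma B of THEOREM MT) and the TP₂ property of the
# elementary symmetric functions of non-negative reals

Support file for the Sahi / Conjecture-P programme of route `PercNearOneGluingNoHeavy`
(`--supports stmt-CriticalPhenomena-4575`, prover prim-l12-p5 gen 30; proof note
`prim-l12-p5/MULTITYPE-PROOF-g30.md`, Lemma 3.4 and Lemma B).  No definitions, no named facts,
no sorries.

THEOREM MT (loc. cit.) — LSM-Z-2D for every multi-type de Finetti law with integer rates — rests on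
three lemmas; the only one that uses `p, q ≤ 1` is LEMMA B, whose core is the following classical
monotonicity of CONDITIONAL POISSON SAMPLING: if `S` is a random `a`-subset of a finite weighted set
with `P(S) ∝ ∏_{e ∈ S} v_e`, then for `f ≠ e` the inclusion probability
`P(f ∈ S) = v_f · e_{a-1}(v_{-f}) / e_a(v)` is non-increasing in `v_e`.  Writing `u` for the weights
other than `v_e, v_f` and `E₀ = e_{a-2}(u)`, `E₁ = e_{a-1}(u)`, `E₂ = e_a(u)`, one has
`e_{a-1}(v_{-f}) = E₁ + v_e E₀`, `e_a(v) = E₂ + (v_e+v_f)E₁ + v_e v_f E₀`, and the claim is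
equivalent to the (weak) Newton inequality `E₀ E₂ ≤ E₁²`.

(The recursion `e_{k+1}(a ∷ s) = e_{k+1}(s) + a e_k(s)`, `e₀ = 1` and `e_k ≥ 0` are imported from
`Literature.Geometry.Riemannian.TwoConvexSchoenfliesProofs`.)

* `esymm_tp2` : for a multiset `s` of non-negative reals and `i ≤ j`,
  `e_i(s) · e_{j+1}(s) ≤ e_{i+1}(s) · e_j(s)` (all `2 × 2` minors of the Toeplitz matrix of
  `(e_k)` with adjacent columns are `≥ 0`; induction on `s`);
* `esymm_log_concave` : `e_k(s) e_{k+2}(s) ≤ e_{k+1}(s)²`;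
* `cp_core`, `cp_inclusion_antitone`, `cp_inclusion_antitone_div` : the conditional-Poisson
  monotonicity in cross-multiplied and in ratio form.
-/

namespace Summit.CriticalPhenomena.PercolationContinuityZ3.Theorems

namespace CPMonotone

open Literature.Geometry.Riemannian (esymm_zero_eq_one esymm_cons_succ esymm_nonneg_of_forall_nonneg)

/-- `e_{k+1}(∅) = 0`. -/
theorem esymm_empty_succ (k : ℕ) : (0 : Multiset ℝ).esymm (k + 1) = 0 := by
  simp [Multiset.esymm, Multiset.powersetCard_eq_empty]

/-- **TP₂ of the elementary symmetric functions of non-negative reals** (weak Newton / log-concavity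
in Toeplitz form): for `i ≤ j`, `e_i(s) · e_{j+1}(s) ≤ e_{i+1}(s) · e_j(s)`.  Induction on `s`: with
`U(i,j) = e_{i+1}e_j − e_ie_{j+1}` and `e'_{k+1} = e_{k+1} + a e_k`,
`U'(i,j) = U(i,j) + a (U(i,j-1) + U(i-1,j)) + a² U(i-1,j-1)`. -/
theorem esymm_tp2 (s : Multiset ℝ) (hs : ∀ a ∈ s, 0 ≤ a) :
    ∀ i j : ℕ, i ≤ j → s.esymm i * s.esymm (j + 1) ≤ s.esymm (i + 1) * s.esymm j := by
  induction s using Multiset.induction_on with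
  | empty =>
    intro i j _
    rw [esymm_empty_succ, esymm_empty_succ, mul_zero, zero_mul]
  | cons a s ih =>
    intro i j hij
    have ha : 0 ≤ a := hs a (Multiset.mem_cons_self a s)
    have hs' : ∀ b ∈ s, 0 ≤ b := fun b hb => hs b (Multiset.mem_cons_of_mem hb)
    have IH := ih hs'
    have NN := esymm_nonneg_of_forall_nonneg s hs'
    rcases Nat.eq_or_lt_of_le hij with h | h
    · subst h
      rw [mul_comm]
    · obtain ⟨j', rfl⟩ : ∃ j', j = j' + 1 := ⟨j - 1, by omega⟩
      cases i with
      | zero =>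
        -- U'(0, j'+1) = U(0, j'+1) + a e₁ e_{j'} + a² e₀ e_{j'}
        rw [esymm_zero_eq_one, esymm_cons_succ, esymm_cons_succ, esymm_cons_succ, esymm_zero_eq_one, one_mul]
        have h1 := IH 0 (j' + 1) (Nat.zero_le _)
        rw [esymm_zero_eq_one, one_mul] at h1
        have h2 : 0 ≤ a * (s.esymm 1 * s.esymm j') := mul_nonneg ha (mul_nonneg (NN 1) (NN j'))
        have h3 : 0 ≤ a * a * s.esymm j' := mul_nonneg (mul_nonneg ha ha) (NN j')
        nlinarith [h1, h2, h3, zero_add (0:ℝ)]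
      | succ i' =>
        -- U'(i'+1, j'+1) = U(i'+1,j'+1) + a (U(i'+1,j') + U(i',j'+1)) + a² U(i',j')
        have hi'j' : i' < j' := by omega
        rw [esymm_cons_succ, esymm_cons_succ, esymm_cons_succ, esymm_cons_succ]
        have h1 := IH (i' + 1) (j' + 1) (by omega)
        have h2 := IH (i' + 1) j' (by omega)
        have h3 := IH i' (j' + 1) (by omega)
        have h4 := IH i' j' (by omega)
        have m2 : 0 ≤ a * (s.esymm (i' + 1 + 1) * s.esymm j' - s.esymm (i' + 1) * s.esymm (j' + 1)) :=
          mul_nonneg ha (by linarith)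
        have m3 : 0 ≤ a * (s.esymm (i' + 1) * s.esymm (j' + 1) - s.esymm i' * s.esymm (j' + 1 + 1)) :=
          mul_nonneg ha (by linarith)
        have m4 : 0 ≤ a * a * (s.esymm (i' + 1) * s.esymm j' - s.esymm i' * s.esymm (j' + 1)) :=
          mul_nonneg (mul_nonneg ha ha) (by linarith)
        nlinarith [h1, m2, m3, m4]

/-- **Log-concavity (weak Newton inequality)** for non-negative reals: `e_k e_{k+2} ≤ e_{k+1}²`. -/
theorem esymm_log_concave (s : Multiset ℝ) (hs : ∀ a ∈ s, 0 ≤ a) (k : ℕ) :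
    s.esymm k * s.esymm (k + 2) ≤ s.esymm (k + 1) * s.esymm (k + 1) :=
  esymm_tp2 s hs k (k + 1) (Nat.le_succ k)

/-- **The algebraic core of conditional-Poisson monotonicity.**  If `E₀E₂ ≤ E₁²` and `v_e ≤ v_e'`
then `(E₁ + v_e' E₀)(E₂ + (v_e+v_f)E₁ + v_e v_f E₀) ≤ (E₁ + v_e E₀)(E₂ + (v_e'+v_f)E₁ + v_e' v_f E₀)`;
indeed the difference is `(v_e' − v_e)(E₁² − E₀E₂)`. -/
theorem cp_core (E₀ E₁ E₂ ve ve' vf : ℝ) (hlc : E₀ * E₂ ≤ E₁ * E₁) (hve : ve ≤ ve') :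
    (E₁ + ve' * E₀) * (E₂ + (ve + vf) * E₁ + ve * vf * E₀) ≤
      (E₁ + ve * E₀) * (E₂ + (ve' + vf) * E₁ + ve' * vf * E₀) := by
  have key : (E₁ + ve * E₀) * (E₂ + (ve' + vf) * E₁ + ve' * vf * E₀) -
      (E₁ + ve' * E₀) * (E₂ + (ve + vf) * E₁ + ve * vf * E₀) = (ve' - ve) * (E₁ * E₁ - E₀ * E₂) := by
    ring
  have h : 0 ≤ (ve' - ve) * (E₁ * E₁ - E₀ * E₂) := mul_nonneg (by linarith) (by linarith)
  linarith [key, h]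

/-- **Conditional-Poisson monotonicity, cross-multiplied form** (MULTITYPE-PROOF-g30, Lemma 3.4).
Let `u` be the multiset of the (non-negative) weights of the units other than `e, f`, sample size
`a = k + 2`, and `E₀ = e_k(u)`, `E₁ = e_{k+1}(u)`, `E₂ = e_{k+2}(u)`.  The inclusion probability of `f`
is `v_f (E₁ + v_e E₀) / (E₂ + (v_e+v_f)E₁ + v_e v_f E₀)`; raising `v_e` to `v_e' ≥ v_e` does not
increase it:  numerator(v_e') · denominator(v_e) ≤ numerator(v_e) · denominator(v_e'). -/
theorem cp_inclusion_antitone (u : Multiset ℝ) (hu : ∀ x ∈ u, 0 ≤ x) (k : ℕ) (ve ve' vf : ℝ)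
    (hve : ve ≤ ve') :
    (u.esymm (k + 1) + ve' * u.esymm k) *
        (u.esymm (k + 2) + (ve + vf) * u.esymm (k + 1) + ve * vf * u.esymm k) ≤
      (u.esymm (k + 1) + ve * u.esymm k) *
        (u.esymm (k + 2) + (ve' + vf) * u.esymm (k + 1) + ve' * vf * u.esymm k) :=
  cp_core _ _ _ _ _ _ (esymm_log_concave u hu k) hve

/-- **Conditional-Poisson monotonicity, ratio form**: with positive weights `v_f > 0`,
`0 < v_e ≤ v_e'` and sample size `a = k+2` feasible for the units other than `e, f` together with
`f` (i.e. `e_{k+1}(u) > 0`, which makes both denominators positive), the inclusion probability of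
`f` satisfies `P_{v_e'}(f ∈ S) ≤ P_{v_e}(f ∈ S)`. -/
theorem cp_inclusion_antitone_div (u : Multiset ℝ) (hu : ∀ x ∈ u, 0 ≤ x) (k : ℕ) (ve ve' vf : ℝ)
    (hve0 : 0 < ve) (hve : ve ≤ ve') (hvf : 0 < vf) (hE₁ : 0 < u.esymm (k + 1)) :
    vf * (u.esymm (k + 1) + ve' * u.esymm k) /
        (u.esymm (k + 2) + (ve' + vf) * u.esymm (k + 1) + ve' * vf * u.esymm k) ≤
      vf * (u.esymm (k + 1) + ve * u.esymm k) /
        (u.esymm (k + 2) + (ve + vf) * u.esymm (k + 1) + ve * vf * u.esymm k) := by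
  have NN := esymm_nonneg_of_forall_nonneg u hu
  have hD : 0 < u.esymm (k + 2) + (ve + vf) * u.esymm (k + 1) + ve * vf * u.esymm k := by
    have : 0 < (ve + vf) * u.esymm (k + 1) := mul_pos (by linarith) hE₁
    nlinarith [NN (k + 2), NN k, mul_nonneg (mul_nonneg hve0.le hvf.le) (NN k)]
  have hD' : 0 < u.esymm (k + 2) + (ve' + vf) * u.esymm (k + 1) + ve' * vf * u.esymm k := by
    have : 0 < (ve' + vf) * u.esymm (k + 1) := mul_pos (by linarith) hE₁
    have hve'0 : 0 ≤ ve' := by linarith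
    nlinarith [NN (k + 2), NN k, mul_nonneg (mul_nonneg hve'0 hvf.le) (NN k)]
  rw [div_le_div_iff₀ hD' hD]
  have h := cp_inclusion_antitone u hu k ve ve' vf hve
  have := mul_le_mul_of_nonneg_left h hvf.le
  nlinarith [this]

/-- **Sample size `a = 1`** (no `e_{a-2}` term): `P(f ∈ S) = v_f/(e₁(u) + v_e + v_f)` is non-increasing
in `v_e` (cross-multiplied form). -/
theorem cp_inclusion_antitone_one (σ ve ve' vf : ℝ) (hvf : 0 ≤ vf) (hve : ve ≤ ve') :
    vf * (σ + ve + vf) ≤ vf * (σ + ve' + vf) :=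
  mul_le_mul_of_nonneg_left (by linarith) hvf

end CPMonotone

end Summit.CriticalPhenomena.PercolationContinuityZ3.Theorems
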